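import Literature.MathematicalPhysics.KineticTheory.HydrodynamicLimits
import Literature.Analysis.FluidPDE.HydrodynamicLimitProofs
import Literature.Analysis.FunctionSpaces.TorusClassicalNSGluing

/-!
# Proofs for `Literature.MathematicalPhysics.KineticTheory.HydrodynamicLimits`
(family `hilbert6`, statement **hilbert6.S15**; companion ("Proofs") file discharging named facts
of `Literature.MathematicalPhysics.KineticTheory.HydrodynamicLimits`. This file is SHARED by
several discharges: extend it by appending a new section to the current tree version — never
replace it wholesale.)

Contents:

1. `Literature.MathematicalPhysics.KineticTheory.hydrodynamic_scaling_classical_isMild_holds` —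
   classical solutions of the scaled Boltzmann equation `St ∂ₜf + v·∇ₓf = Kn⁻¹ Q_B(f, f)`
   (Saint-Raymond, LNM 1971, §2.2.1 eq. (2.18)) on `[0, T] × ℝ^d × ℝ^d`, `St, Kn > 0`, are mild
   scaled solutions for the whole-space geometry (section `ClassicalScaledIsMild`).
2. `Literature.MathematicalPhysics.KineticTheory.deng_hani_ma_hilbert6.global_two` — the proved
   *global `d = 2` reading* of the Deng–Hani–Ma statement of **hilbert6.S18** (section `DHMGlue`),
   as a CONDITIONAL COROLLARY of the named fact `deng_hani_ma_hilbert6`: on `T²`, the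
   smooth-lifespan form `deng_hani_ma_hilbert6` plus global smooth well-posedness of 2-D
   Navier–Stokes (explicit hypothesis `hNS`) give convergence of the rescaled empirical velocity
   fields on every horizon `[0, T]` towards one global smooth solution. No fact is added. History:
   this reading was first vendored as a separate named fact (the "`d = 2` global form" of
   hilbert6.S18, an M5 demotion) with this glue concluding it (`…_two_of`, p28955); the
   review-split seat of 2026-08-15 found that form to be no printed result — arXiv:2503.01800
   Thm. 2 fixes a smooth fluid solution on `[0, T_fin]` and merely remarks that `T_fin` "is allowed
   to grow to infinity" IF that solution is global, and never invokes 2-D global regularity — so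
   the named fact is merged back into its parent's obligation: it is retired from the statement
   file and survives exactly as this conditional theorem. (The one-line derivation, with the
   identity extraction `φ = id`, of the "Leray reading on the lifespan"
   `deng_hani_ma_hilbert6_subseq` from `deng_hani_ma_hilbert6` formerly lived here as
   `deng_hani_ma_hilbert6_subseq_of`; it is withdrawn from this file (verdict clean-up
   2026-08-15) so that the statement file can carry that sanity link itself, as the conditional
   theorem its docstring always described, instead of an undischargeable named fact.)
3. `Literature.MathematicalPhysics.KineticTheory.exists_isAdmissibleJointLimit_le` — admissible
   joint limits exist below every growth function `A → ∞` at `0⁺` (section `DHMNonVacuity`):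
   the existentially quantified admissible rate shared by the hilbert6.S18 statements can never
   be chosen so as to empty the universal quantifier over joint limits, so none of them has a
   vacuous discharge.

## 1. Classical scaled solutions are mild scaled solutions (hilbert6.S15)

The named fact `hydrodynamic_scaling_classical_isMild` is, by its own docstring, the id-carrying
restatement (velocity/position index type `ι`) of the prelude fact
`Literature.Analysis.FluidPDE.IsClassicalScaledBoltzmannSolutionOn.isMildScaledBoltzmannSolutionOn`
(index type `d`), which is discharged in the tree by
`Literature.Analysis.FluidPDE.IsClassicalScaledBoltzmannSolutionOn.isMildScaledBoltzmannSolutionOn_holds`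
(`Literature.Analysis.FluidPDE.HydrodynamicLimitProofs`: chain rule in time for `τ ↦ f (St τ)`,
`collisionOpWith_smul` for the kernel `Kn⁻¹ • B`, then the K4 discharge
`IsClassicalBoltzmannSolutionOn.isMildBoltzmannSolutionOn_holds` = characteristics + FTC).
The discharge below is that reduction, instantiated at `d := ι`; no statement is changed.

## 2. Glue for the Deng–Hani–Ma statements (hilbert6.S18)

* `deng_hani_ma_hilbert6.global_two` — the global `d = 2` reading: on `T²`
  (`Fintype.card ι = 2`), for a smooth divergence-free datum `u₀`, there is a global smooth
  solution `(u, p)` of incompressible Navier–Stokes with viscosity `hardSphereViscosity 2` and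
  `u 0 = u₀` to which, on every horizon `[0, T]`, the rescaled empirical velocity fields of hard
  spheres with canonical local-Maxwellian data converge in probability along every admissible
  joint limit below some growth function `A → ∞` at `0⁺` (depending on `T`). It follows from
  `deng_hani_ma_hilbert6` (hypothesis `hDHM`; Deng–Hani–Ma, arXiv:2503.01800, Thm. 2, PDF p. 8:
  convergence on the lifespan `[0, T_fin]` of a fixed smooth solution of the incompressible
  Navier–Stokes(–Fourier) system (1.19), `d ∈ {2, 3}`; "if the solution `(u, ρ)` is global in
  time, then `T_fin` is allowed to grow") together with **global smooth well-posedness of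
  incompressible Navier–Stokes on `T²`** for smooth divergence-free data (Ladyzhenskaya 1959;
  Kuksin–Shirikyan 2012, Thm. 2.1.13 (PDF p. 52, global existence and uniqueness) with
  Thm. 2.1.19 (PDF p. 57, `Hᵐ` regularity for every `m`) and the remark after its proof, PDF
  p. 59: "if the right-hand side is infinitely smooth, then so is the solution"), taken as the
  explicit hypothesis `hNS` in the vocabulary of the accepted `Torus.IsClassicalNSSolutionOn (Ici 0)`
  — the tree has no named fact for it yet and this proof file deliberately does not mint one
  (D-0026). The proof: restrict the global classical solution to `[0, T]`
  (`Torus.IsClassicalNSSolutionOn.mono`, `uniqueDiffOn_Icc`) and apply the lifespan form with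
  `d = card ι = 2`. The paper itself proves neither ingredient of the `d = 2` specialisation
  beyond Thm. 2: it does not state 2-D global regularity, so this corollary is kept conditional
  on both hypotheses and is NOT a named fact (review-split 2026-08-15, merging the former
  "`d = 2` global form" of hilbert6.S18 back into `deng_hani_ma_hilbert6`).

### Faithfulness notes on `deng_hani_ma_hilbert6` (and its `d = 2` corollary) versus the printed Theorem 2

Read against arXiv:2503.01800 v1, Thm. 2 (PDF p. 8) and its proof (PDF p. 9), the tree's
statements are an *idealised mode-B reading* and are formally **stronger than what is printed**
in the following respects (recorded for the statement owners; nothing below depends on them):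
(1) DHM take the **grand-canonical** ensemble of their Definition 1.3 with `α = δ⁻¹` and
`𝔼(N) ≈ ε^{-(d-1)} δ⁻¹` ((1.25)); the tree uses canonical data with `Nₖ εₖ^{d-1} = αₖ` exactly.
(2) DHM's one-particle datum is the *linearised* perturbation (1.21),
`n₀ = M (1 + δ((2 + d - |v|²)/2 · ρ₀ + v·u₀)) + δ⁴ e^{-|v|²/4} g_R ≥ 0`, with `(u₀, ρ₀)` of zero
mean on `T^d` (Prop. 1.6); the tree uses the genuine local Maxwellian `M_{1, δu₀, 1}` (`dhmProfile`,
an `O(δ²)` deviation not of the form `δ⁴ e^{-|v|²/4} g_R` with (1.20)) and imposes no zero-mean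
condition on `u₀`. (3) DHM's empirical field (1.28) carries the velocity cut-off
`1_{|v_j(t)| ≤ ε^{-κ}}`, `κ = θ/4` (Remark 1.7: "merely for technical reasons"); the tree's
`empiricalVelocity` is untruncated. (4) DHM test against "any test function `ψ(x)`"; the tree
tests against all continuous `χ`. (5) The viscosity `μ₁` of (1.19) is "a positive absolute
constant depending on `d`; for exact expressions see [29]" (Gallagher–Tristani); its agreement
with the tree's `hardSphereViscosity d` is unverified (as that definition's docstring says).
The admissible-rate abstraction `∃ A → ∞, αₖ ≤ A(εₖ)` is implied by the printed (1.24),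
`max(1, δ⁻¹) · max(1, δ⁻¹ T_fin) ≪ (log|log ε|)^{1/2}`, along sequences `εₖ → 0`.

## 3. Non-vacuity of the abstract admissible rate (hilbert6.S18)

The hilbert6.S18 statements (`deng_hani_ma_hilbert6`, its global `d = 2` corollary
`deng_hani_ma_hilbert6.global_two`, `DengHaniMaLerayLimit`, and the lifespan Leray reading
`deng_hani_ma_hilbert6_subseq`) all assert
the existence of a growth function `A → ∞` at `0⁺` such that SOMETHING holds along every
admissible joint limit `(Nₖ, εₖ, αₖ)` with `αₖ ≤ A(εₖ)`. None of them is vacuously true from the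
hypothesis side, which is the content of this section: `exists_isAdmissibleJointLimit_le` shows
that below EVERY growth function `A → ∞` at `0⁺` there is an admissible joint limit
`(Nₖ, εₖ, αₖ)` (`IsAdmissibleJointLimit`) with `αₖ ≤ A(εₖ)` for all `k` — choose
`0 < εₖ < 1/(k+1)` with `A(εₖ) > k + 1` (possible since `A → ∞` along `𝓝[>] 0`) and
`Nₖ = ⌊A(εₖ)/εₖ^{d-1}⌋`, so that `k < A(εₖ) - εₖ^{d-1} < αₖ ≤ A(εₖ)`. So the universal quantifier
over joint limits always has instances, whatever growth function is offered, and a discharge of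
any of the Deng–Hani–Ma claims (arXiv:2503.01800, Thm. 2 (2), PDF p. 8, (1.28)–(1.29) under
(1.24)) has to produce the convergence itself.

## References

* L. Saint-Raymond, *Hydrodynamic Limits of the Boltzmann Equation*, LNM 1971 (2009), §2.2.1
  "Nondimensional Form of the Boltzmann Equation", eq. (2.18) (bib key `SaintRaymond2009`).
* I. Gallagher, L. Saint-Raymond, B. Texier, *From Newton to Boltzmann: hard spheres and
  short-range potentials*, EMS (2013), arXiv:1208.5753, Part I Ch. 2 §2.1 (2.1.1) (mild form;
  bib key `GallagherSaintRaymondTexier2013`).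
* Y. Deng, Z. Hani, X. Ma, *Hilbert's sixth problem: derivation of fluid equations via
  Boltzmann's kinetic theory*, arXiv:2503.01800 (2025), Thm. 2, Prop. 1.6, Remark 1.7; *Long
  time derivation of the Boltzmann equation from hard sphere dynamics*, arXiv:2408.07818 (2024),
  Thm. 1 (bib key `DengHaniMa2024`).
* S. Kuksin, A. Shirikyan, *Mathematics of Two-Dimensional Turbulence*, CUP 2012, Thms. 2.1.13,
  2.1.19 (bib key `KuksinShirikyan2012`).
-/

open MeasureTheory Metric Real Set Filter Function

noncomputable section

namespace Literature.MathematicalPhysics.KineticTheory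

/-! ## 1. Classical scaled solutions are mild scaled solutions (LNM 1971 §2.2.1 (2.18)) -/

section ClassicalScaledIsMild

variable {ι : Type*} [Fintype ι]

/-- Discharge of **hilbert6.S15** `hydrodynamic_scaling_classical_isMild`: for `St, Kn > 0`, a
nonnegative `C¹` solution of the scaled Boltzmann equation `St ∂ₜf + v·∇ₓf = Kn⁻¹ Q_B(f, f)`
(Saint-Raymond, LNM 1971, §2.2.1 eq. (2.18)) on `[0, T] × ℝ^ι × ℝ^ι`
(`Literature.Analysis.FluidPDE.IsClassicalScaledBoltzmannSolutionOn (Icc 0 T) St Kn B f`) is a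
mild scaled solution for the whole-space geometry
(`Literature.Analysis.FluidPDE.IsMildScaledBoltzmannSolutionOn T (Euclidean.geometry ι) B St Kn f`:
the time-dilated density `τ ↦ f (St τ)` satisfies Duhamel's formula along the free flow on
`[0, T / St]` for the kernel `Kn⁻¹ • B`). Proof: the statement is literally the prelude fact
`Literature.Analysis.FluidPDE.IsClassicalScaledBoltzmannSolutionOn.isMildScaledBoltzmannSolutionOn`
at index type `d := ι`, discharged by
`Literature.Analysis.FluidPDE.IsClassicalScaledBoltzmannSolutionOn.isMildScaledBoltzmannSolutionOn_holds`
(chain rule in time + reduction to the unscaled K4 discharge by characteristics and the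
fundamental theorem of calculus). [cite: SaintRaymond2009, §2.2.1 (2.18)] -/
theorem hydrodynamic_scaling_classical_isMild_holds :
    hydrodynamic_scaling_classical_isMild (ι := ι) := by
  intro T St Kn B f hf hSt hKn
  exact Literature.Analysis.FluidPDE.IsClassicalScaledBoltzmannSolutionOn.isMildScaledBoltzmannSolutionOn_holds
    hf hSt hKn

end ClassicalScaledIsMild

/-! ## 2. Glue for the Deng–Hani–Ma statements (hilbert6.S18; arXiv:2503.01800 Thm. 2) -/

section DHMGlue

open scoped _root_.Topology

variable {ι : Type*} [Fintype ι] [DecidableEq ι]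

/-- **hilbert6.S18, global `d = 2` reading** (conditional corollary of `deng_hani_ma_hilbert6`).
ASSUMING the Deng–Hani–Ma claim in its smooth-lifespan form `deng_hani_ma_hilbert6` (hypothesis
`hDHM`; Deng–Hani–Ma, arXiv:2503.01800v1, Thm. 2 (2), PDF p. 8: convergence on the lifespan
`[0, T_fin]` of a FIXED smooth fluid solution, `d ∈ {2, 3}`, with the printed remark "if the
solution `(u, ρ)` is global in time, then `T_fin` is allowed to grow to infinity as `ε, δ → 0`";
tree variant with the deviations (a)–(f) of the statement file's module docstring) AND global
smooth well-posedness of the incompressible Navier–Stokes equations on `T²` with viscosity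
`hardSphereViscosity 2` for smooth divergence-free data (hypothesis `hNS`, in the vocabulary of
`Torus.IsClassicalNSSolutionOn (Ici 0)`; Ladyzhenskaya 1959, Kuksin–Shirikyan 2012 Thms. 2.1.13,
2.1.19 — a theorem the paper does not state and the tree does not yet carry as a named fact):
on `T²` (`Fintype.card ι = 2`), for every smooth divergence-free `u₀` there is a global smooth
solution `(u, p)`, `u 0 = u₀`, such that for every horizon `T > 0` there is a growth function
`A → ∞` at `0⁺` (depending on `T`) below which, along every admissible joint limit
`(Nₖ, εₖ, αₖ)` and for all hard-sphere flows `Φₖ` with canonical local-Maxwellian data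
`M_{1, αₖ⁻¹u₀, 1}`, the rescaled empirical velocity fields converge in probability on `[0, T]`
to `u` (`TendstoEmpiricalVelocityOn`). Proof: take the global classical solution issued from
`u₀`, restrict it to `[0, T]` (`Torus.IsClassicalNSSolutionOn.mono` with `uniqueDiffOn_Icc`) and
apply the lifespan form with `d = card ι = 2`, whose growth function is the one produced.
History: this statement was the separate named fact "hilbert6.S18, `d = 2` global form" concluded
by the glue `…_two_of` (p28955); not being a printed result (Thm. 2 ∘ 2-D global regularity), it
was merged back into `deng_hani_ma_hilbert6` by the review-split seat (2026-08-15) and survives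
as this conditional theorem only. [claim: DengHaniMa2024, status: under-review] -/
theorem deng_hani_ma_hilbert6.global_two (hDHM : deng_hani_ma_hilbert6 (ι := ι))
    (hNS : ∀ u₀ : UnitAddTorus ι → EuclideanSpace ℝ ι,
      Literature.Analysis.FunctionSpaces.Torus.IsSmooth u₀ →
      Literature.Analysis.FunctionSpaces.Torus.IsDivFree u₀ →
      ∃ (u : ℝ → UnitAddTorus ι → EuclideanSpace ℝ ι) (p : ℝ → UnitAddTorus ι → ℝ),
        Literature.Analysis.FunctionSpaces.Torus.IsClassicalNSSolutionOn (Ici 0)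
          (hardSphereViscosity 2) 0 u p ∧ u 0 = u₀)
    (hι : Fintype.card ι = 2) {u₀ : UnitAddTorus ι → EuclideanSpace ℝ ι}
    (hu₀ : Literature.Analysis.FunctionSpaces.Torus.IsSmooth u₀)
    (hdiv : Literature.Analysis.FunctionSpaces.Torus.IsDivFree u₀) :
    ∃ (u : ℝ → UnitAddTorus ι → EuclideanSpace ℝ ι) (p : ℝ → UnitAddTorus ι → ℝ),
      Literature.Analysis.FunctionSpaces.Torus.IsClassicalNSSolutionOn (Ici 0)
          (hardSphereViscosity 2) 0 u p ∧ u 0 = u₀ ∧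
      ∀ T > (0 : ℝ), ∃ A : ℝ → ℝ, Tendsto A (𝓝[>] 0) atTop ∧
        ∀ (N : ℕ → ℕ) (ε α : ℕ → ℝ), IsAdmissibleJointLimit ι N ε α → (∀ k, α k ≤ A (ε k)) →
        ∀ Φ : (k : ℕ) → Literature.Analysis.FluidPDE.HardSphereFlow
            (Literature.Analysis.FluidPDE.Torus.geometry ι) (ε k) (N k),
          TendstoEmpiricalVelocityOn T N
            (fun k => Literature.Analysis.FluidPDE.particleLaw (Φ k)
              (Literature.Analysis.FluidPDE.canonicalDensity
                (Literature.Analysis.FluidPDE.Torus.geometry ι) (ε k) (N k)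
                (dhmProfile (α k)⁻¹ u₀)))
            (fun k => (Φ k).flow) α u := by
  obtain ⟨u, p, hu, h0⟩ := hNS u₀ hu₀ hdiv
  refine ⟨u, p, hu, h0, fun T hT => ?_⟩
  have hu' : Literature.Analysis.FunctionSpaces.Torus.IsClassicalNSSolutionOn (Icc 0 T)
      (hardSphereViscosity (Fintype.card ι)) 0 u p := by
    rw [hι]
    exact hu.mono Icc_subset_Ici_self (uniqueDiffOn_Icc hT)
  exact hDHM (Or.inl hι) hT hu' h0

end DHMGlue

/-! ## 3. Non-vacuity of the abstract admissible rate (hilbert6.S18) -/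

section DHMNonVacuity

open scoped _root_.Topology

/-- **Admissible joint limits exist below every growth function.** For every `A : ℝ → ℝ` with
`A(ε) → ∞` as `ε → 0⁺` there are particle numbers `Nₖ`, diameters `εₖ → 0⁺` and inverse Knudsen
numbers `αₖ = Nₖ εₖ^{d-1} → ∞` (`IsAdmissibleJointLimit ι N ε α`, `d = Fintype.card ι`, any
finite `ι`) with `αₖ ≤ A(εₖ)` for all `k`: choose `0 < εₖ < 1/(k+1)` with `A(εₖ) > k + 1` and put
`Nₖ = ⌊A(εₖ)/εₖ^{d-1}⌋`, so that `k < A(εₖ) - εₖ^{d-1} < αₖ ≤ A(εₖ)`. Hence the existentially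
quantified admissible rate in `deng_hani_ma_hilbert6`, `deng_hani_ma_hilbert6.global_two`,
`DengHaniMaLerayLimit` and `deng_hani_ma_hilbert6_subseq` never makes the universally quantified
conclusion vacuous (module docstring, §3). [folklore] -/
theorem exists_isAdmissibleJointLimit_le (ι : Type*) [Fintype ι] {A : ℝ → ℝ}
    (hA : Tendsto A (𝓝[>] 0) atTop) :
    ∃ (N : ℕ → ℕ) (ε α : ℕ → ℝ), IsAdmissibleJointLimit ι N ε α ∧ ∀ k, α k ≤ A (ε k) := by
  -- Step 1: diameters `εₖ ∈ (0, 1/(k+1))` with `A εₖ > k + 1`.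
  have hk : ∀ k : ℕ, ∃ e : ℝ, 0 < e ∧ e < 1 / ((k : ℝ) + 1) ∧ (k : ℝ) + 1 < A e := by
    intro k
    have h1 : ∀ᶠ e in 𝓝[>] (0 : ℝ), e ∈ Ioi (0 : ℝ) := eventually_mem_nhdsWithin
    have h2 : ∀ᶠ e in 𝓝[>] (0 : ℝ), e < 1 / ((k : ℝ) + 1) :=
      eventually_nhdsWithin_of_eventually_nhds (eventually_lt_nhds (by positivity))
    have h3 : ∀ᶠ e in 𝓝[>] (0 : ℝ), (k : ℝ) + 1 < A e := hA.eventually (eventually_gt_atTop _)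
    obtain ⟨e, he0, he1, he2⟩ := (h1.and (h2.and h3)).exists
    exact ⟨e, he0, he1, he2⟩
  choose ε hε0 hεk hAε using hk
  -- Step 2: the two-sided estimate `k < ⌊A εₖ / εₖ^{d-1}⌋ εₖ^{d-1} ≤ A εₖ`.
  have key : ∀ k : ℕ,
      (k : ℝ) < (⌊A (ε k) / ε k ^ (Fintype.card ι - 1)⌋₊ : ℝ) * ε k ^ (Fintype.card ι - 1) ∧
        (⌊A (ε k) / ε k ^ (Fintype.card ι - 1)⌋₊ : ℝ) * ε k ^ (Fintype.card ι - 1) ≤ A (ε k) := by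
    intro k
    have hp : 0 < ε k ^ (Fintype.card ι - 1) := pow_pos (hε0 k) _
    have hk1 : (1 : ℝ) / ((k : ℝ) + 1) ≤ 1 :=
      (div_le_one (by positivity)).2 (le_add_of_nonneg_left (Nat.cast_nonneg k))
    have hε1 : ε k ≤ 1 := (hεk k).le.trans hk1
    have hp1 : ε k ^ (Fintype.card ι - 1) ≤ 1 := pow_le_one₀ (hε0 k).le hε1
    have hA0 : 0 < A (ε k) := by linarith [hAε k, (Nat.cast_nonneg k : (0 : ℝ) ≤ k)]
    set p := ε k ^ (Fintype.card ι - 1) with hp_def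
    set q := A (ε k) / p with hq_def
    have hqp : q * p = A (ε k) := div_mul_cancel₀ _ hp.ne'
    have hq0 : 0 ≤ q := div_nonneg hA0.le hp.le
    refine ⟨?_, ?_⟩
    · have hfl : q - 1 < (⌊q⌋₊ : ℝ) := by linarith [Nat.lt_floor_add_one q]
      calc (k : ℝ) < A (ε k) - 1 := by linarith [hAε k]
        _ ≤ A (ε k) - p := by linarith
        _ = (q - 1) * p := by rw [sub_mul, hqp, one_mul]
        _ < (⌊q⌋₊ : ℝ) * p := mul_lt_mul_of_pos_right hfl hp
    · calc (⌊q⌋₊ : ℝ) * p ≤ q * p := mul_le_mul_of_nonneg_right (Nat.floor_le hq0) hp.le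
        _ = A (ε k) := hqp
  -- Step 3: assemble the admissible joint limit.
  refine ⟨fun k => ⌊A (ε k) / ε k ^ (Fintype.card ι - 1)⌋₊, ε,
    fun k => (⌊A (ε k) / ε k ^ (Fintype.card ι - 1)⌋₊ : ℝ) * ε k ^ (Fintype.card ι - 1),
    ⟨hε0, ?_, fun k => ?_, ?_, fun _ => rfl⟩, fun k => (key k).2⟩
  · exact squeeze_zero (fun k => (hε0 k).le) (fun k => (hεk k).le)
      tendsto_one_div_add_atTop_nhds_zero_nat
  · exact (Nat.cast_nonneg k).trans_lt (key k).1
  · exact tendsto_atTop_mono (fun k => (key k).1.le) tendsto_natCast_atTop_atTop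

end DHMNonVacuity

end Literature.MathematicalPhysics.KineticTheory

end
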